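import Summits.BirchSwinnertonDyer.BirchSwinnertonDyer.Theorems.SchneiderFreeAdditiveX3PoitouTateSelmerDualityHolds
import Summits.BirchSwinnertonDyer.BirchSwinnertonDyer.Theorems.SchneiderFreeAdditiveX3PoitouTateShaDualityHolds
import HarnessLib

/-!
# Stub `stub_pubPoitouTate` of line `threeframes` (crux `TwinSplitIMCAtThreeMult`, stmt-BirchSwinnertonDyer-20694)

Cell `bsd-wall`, stub worker bench-stmt-BirchSwinnertonDyer-20694-pubPoitouTate g0. The stub asks for the two Poitou–Tate
facts at every number field `K`: (PT1) the Greenberg–Wiles / Selmer-structure duality and (PT2) the `Ш`/Tate-dual exactness.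
BOTH are THEOREMS of the tree, landed by bsd-schneider cell door-c4:
- `poitouTate_selmerStructure_duality_holds` (Milne *ADT* I Thm. 4.10 (b) + Cor. 2.3 + Thm. 2.6 + Howard Thm. 2.1.11)
- `poitouTate_sha_tateDual_holds` (Milne *ADT* I Thm. 4.10 (a))

The stub is therefore a trivial conjunction of the two existing theorems. BSD is not proved by this.

References: [MilneADT2006] I Thm. 4.10, Cor. 2.3, Thm. 2.6; [Howard2004HeegnerKolyvagin] Thm. 2.1.11; [Wiles1995] Prop. 1.6.
-/

set_option autoImplicit false

-- D-0017 layout: summit = sub-problem, so `Summit.BirchSwinnertonDyer.BirchSwinnertonDyer.…` is the mandated namespace of Theorems files.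
set_option linter.dupNamespace false

namespace Summit.BirchSwinnertonDyer.BirchSwinnertonDyer.Theorems.UniversalToricDescentTwinPoitouTate

open Literature.NumberTheory.GaloisCohomology
open Summit.BirchSwinnertonDyer.BirchSwinnertonDyer.Theorems.SchneiderFreeAdditiveX3.PoitouTateReduction

/-- **`stub_pubPoitouTate` from tree theorems**: the two Poitou–Tate facts for every number field `K` — (PT1) the
Greenberg–Wiles / Selmer-structure duality `poitouTate_selmerStructure_duality` and (PT2) the `Ш`/Tate-dual exactness
`poitouTate_sha_tateDual` — are THEOREMS of the tree (`poitouTate_selmerStructure_duality_holds`, `poitouTate_sha_tateDual_holds`).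
[cite: MilneADT2006, I Thm. 4.10] [cite: Wiles1995, Prop. 1.6] -/
theorem stub_pubPoitouTate :
    (∀ (K : Type) [Field K] [NumberField K],
      Literature.NumberTheory.GaloisCohomology.poitouTate_selmerStructure_duality K) ∧
    (∀ (K : Type) [Field K] [NumberField K],
      Literature.NumberTheory.GaloisCohomology.poitouTate_sha_tateDual K) :=
  ⟨fun K _ _ ↦ poitouTate_selmerStructure_duality_holds K,
   fun K _ _ ↦ poitouTate_sha_tateDual_holds K⟩

end Summit.BirchSwinnertonDyer.BirchSwinnertonDyer.Theorems.UniversalToricDescentTwinPoitouTate
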